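import Mathlib
import HarnessLib
import Summits.HubbardSuperconductivity.HubbardSuperconductivity.Theorems.KLProgrammeKLRegimeEngineTowerLevBaseFromPlain
import Summits.HubbardSuperconductivity.HubbardSuperconductivity.Theorems.KLProgrammeKLRegimeEngineTowerLevFloorUnitsDefs

/-!
# Route `KLProgramme` — crux K3 ENGINE (stmt-HubbardSuperconductivity-20437 `KLRegimeEngineV17F2`), stub (b) v2, THE LEVELS PACKAGE (ℓ):
# THE BASE LAW IN LEVELLED UNITS — a grid-step-shaped plain bound `ε^{2p−1}·A·P^p` divided by ANY track's unit at family `J` is a profile `A_b·λ^{p−1}·Q_b^p`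
# («(ℓ)-BASE-LEV» part 2a: the `hlawb` input of p4 g19's re-based bridge `hR` of `klTowerBLev_le_law_of_inputs_base`; cell gate-hubbard-kl, seat hubbard-kl-k3c2-p3 g13)

p4 g19's re-based levelled law (…TowerLevLawBase, p669647; cure (A″) of located-risk #8) reads the base `𝒱_d` at `F_{d−1}` through a track-independent plain
datum `N_b p` with `hNb : klLevNormOf … (d−1) (2p) (klTowerInput … d 1) Ωe′ ≤ N_b p` (every prescription; = `klLevNormOf_le_of_wtPinned`, …TowerLevBaseFromPlain,
fed by p3's F2′ `klWtPinnedSumAt_klEffectiveAction_fam_le_of_wgridStep` at `(Λ_d, F_{d−1})`) and a UNIT LAW `hlawb : N_b p / klLevUnit … t p (d−1) ≤ A_b·λ^{p−1}·Q_b^p`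
for every track `t`.  This file supplies the unit law for grid-step-shaped data `N_b p = ε^{2p−1}·A·P^p` (the shape F2′ delivers), in both keyings:

* `klLevUnit_zero_le_four_pow_mul` — `klLevUnit … 0 p J ≤ 4^J·klLevUnit … t p J` (the level gain of any track is at most `4^J`); floor twin `klLevUnitF_zero_le_four_pow_mul`;
* **`gridLaw_div_klLevUnit_le`** — `ε^{2p−1}·A·P^p / klLevUnit … t p J ≤ (2^{7J}·A·λ)·λ^{p−1}·(P/(8^J·λ))^p` (`p ≥ 1`, `λ > 0`, any `t`): `A_b = 2^{7J}Aλ`, `Q_b = P/(8^Jλ)`;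
* **`gridLaw_div_klLevUnitF_le`** — the same for the floor units `klLevUnitF` (p668906);
* `klTowerMuLevF_le_profile_of_wtPinned` — the floor twin of `klTowerMuLev_le_profile_of_wtPinned` (free transfer by `klTowerMuLevF_le_klTowerMuLev`).
Real algebra over landed definitions; nothing about the model is asserted; nothing asserts (ℓ), any stub, K3 or superconductivity.
References: BGM 2006 §2.8 (2.83), (2.93)–(2.98) [cite: BenfattoGiulianiMastropietro2006].
-/

noncomputable section

namespace Summit.HubbardSuperconductivity.HubbardSuperconductivity.Theorems.EngineV8

set_option linter.dupNamespace false -- summit = problem name (single-conjunct summit), D-0017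

open Classical
open Real Finset Literature.MathematicalPhysics.QuantumLattice Literature.Probability.LatticeModels GrassmannAlgebra
open Literature.MathematicalPhysics.QuantumLattice.FermiRG
open Summit.HubbardSuperconductivity.HubbardSuperconductivity.Theorems.KLRegimeSplit
open Summit.HubbardSuperconductivity.HubbardSuperconductivity.Theorems.KLProgrammeLegKernels
open Summit.HubbardSuperconductivity.HubbardSuperconductivity.Theorems.DispersionFlow

variable {L M : ℕ} [NeZero L]

/-! ## §1 Track units against the track-`0` unit -/

omit [NeZero L] in
/-- **The track-`0` unit is at most `4^J` times any track's unit** (half keying: `(√2)^{tJ} ≤ 4^J`). [folklore] -/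
theorem klLevUnit_zero_le_four_pow_mul [NeZero M] {β : ℝ} (hβ : 0 < β) (t : Fin 5) (p J : ℕ) :
    klLevUnit β M 0 p J ≤ (4 : ℝ) ^ J * klLevUnit β M t p J := by
  have hu0 : 0 < klLevUnit β M 0 p J := klLevUnit_pos hβ 0 p J
  have hs0 : 0 < Real.sqrt 2 ^ ((t : ℕ) * J) := by positivity
  rw [klLevUnit_eq_zero_track_div β t p J, mul_div_assoc', le_div_iff₀ hs0]
  exact mul_le_mul_of_nonneg_left (sqrt_two_pow_track_le t J) hu0.le |>.trans_eq (mul_comm _ _)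

omit [NeZero L] in
/-- **Floor keying: the track-`0` unit is at most `4^J` times any track's floor unit** (`2^{klLevGain t·J} ≤ 4^J`). [folklore] -/
theorem klLevUnitF_zero_le_four_pow_mul [NeZero M] {β : ℝ} (hβ : 0 < β) (t : Fin 5) (p J : ℕ) :
    klLevUnit β M 0 p J ≤ (4 : ℝ) ^ J * klLevUnitF β M t p J :=
  (klLevUnit_zero_le_four_pow_mul hβ t p J).trans
    (mul_le_mul_of_nonneg_left (klLevUnit_le_klLevUnitF hβ.le M t p J) (by positivity))

/-! ## §2 The grid-shaped base law in levelled units -/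

omit [NeZero L] in
/-- The track-`0` computation: `ε^{2p−1}·A·P^p·4^J / klLevUnit … 0 p J = (2^{7J}·A·λ)·λ^{p−1}·(P/(8^J·λ))^p` (`p ≥ 1`, `λ ≠ 0`). [folklore] -/
theorem gridLaw_mul_four_pow_div_klLevUnit_zero {β : ℝ} {M : ℕ} [NeZero M] (hβ : 0 < β) {A P lam : ℝ} (hlam : lam ≠ 0) {p : ℕ} (hp : 1 ≤ p) (J : ℕ) :
    imagTimeWeight β M ^ (2 * p - 1) * A * P ^ p * (4 : ℝ) ^ J / klLevUnit β M 0 p J =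
      ((2 : ℝ) ^ (7 * J) * A * lam) * lam ^ (p - 1) * (P / ((8 : ℝ) ^ J * lam)) ^ p := by
  have hx : 0 < imagTimeWeight β M := by
    unfold imagTimeWeight
    have : (0 : ℝ) < M := Nat.cast_pos.2 (Nat.pos_of_ne_zero (NeZero.ne M))
    positivity
  rw [klLevUnit_zero_track]
  have hε : imagTimeWeight β M ^ (2 * p - 1) ≠ 0 := (pow_pos hx _).ne'
  have h80 : (8 : ℝ) ^ J ≠ 0 := by positivity
  have h27 : (2 : ℝ) ^ (7 * J) = (2 : ℝ) ^ (5 * J) * (4 : ℝ) ^ J := by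
    rw [show (4 : ℝ) = 2 ^ 2 by norm_num, ← pow_mul, ← pow_add]; ring_nf
  obtain ⟨n, rfl⟩ : ∃ n, p = n + 1 := ⟨p - 1, by omega⟩
  rw [Nat.add_sub_cancel, h27, show (8 : ℝ) ^ (J * (n + 1)) = ((8 : ℝ) ^ J) ^ (n + 1) by rw [pow_mul], div_pow, mul_pow ((8 : ℝ) ^ J)]
  rw [div_div_eq_mul_div, div_eq_iff (mul_ne_zero hε (pow_ne_zero _ h80))]
  field_simp
  ring

omit [NeZero L] in
/-- **THE GRID-SHAPED BASE LAW IN HALF-KEYED LEVELLED UNITS**: for `N_b p = ε^{2p−1}·A·P^p` (`A, P ≥ 0`), every track `t`, `p ≥ 1`, `λ > 0`: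
`N_b p / klLevUnit … t p J ≤ (2^{7J}·A·λ)·λ^{p−1}·(P/(8^J·λ))^p` — the `hlawb` input of the re-based bridge with `A_b = 2^{7J}Aλ`, `Q_b = P/(8^Jλ)`.
[cite: BenfattoGiulianiMastropietro2006, §2.8 (2.83), (2.93)-(2.98)] -/
theorem gridLaw_div_klLevUnit_le [NeZero M] {β : ℝ} (hβ : 0 < β) {A P lam : ℝ} (hA : 0 ≤ A) (hP : 0 ≤ P) (hlam : 0 < lam)
    (t : Fin 5) {p : ℕ} (hp : 1 ≤ p) (J : ℕ) :
    imagTimeWeight β M ^ (2 * p - 1) * A * P ^ p / klLevUnit β M t p J ≤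
      ((2 : ℝ) ^ (7 * J) * A * lam) * lam ^ (p - 1) * (P / ((8 : ℝ) ^ J * lam)) ^ p := by
  have hε : 0 ≤ imagTimeWeight β M := imagTimeWeight_nonneg hβ.le M
  have hN0 : 0 ≤ imagTimeWeight β M ^ (2 * p - 1) * A * P ^ p := by positivity
  have hut : 0 < klLevUnit β M t p J := klLevUnit_pos hβ t p J
  have hu0 : 0 < klLevUnit β M 0 p J := klLevUnit_pos hβ 0 p J
  rw [← gridLaw_mul_four_pow_div_klLevUnit_zero (M := M) hβ hlam.ne' hp J, div_le_div_iff₀ hut hu0]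
  calc imagTimeWeight β M ^ (2 * p - 1) * A * P ^ p * klLevUnit β M 0 p J
      ≤ imagTimeWeight β M ^ (2 * p - 1) * A * P ^ p * ((4 : ℝ) ^ J * klLevUnit β M t p J) :=
        mul_le_mul_of_nonneg_left (klLevUnit_zero_le_four_pow_mul hβ t p J) hN0
    _ = imagTimeWeight β M ^ (2 * p - 1) * A * P ^ p * (4 : ℝ) ^ J * klLevUnit β M t p J := by ring

omit [NeZero L] in
/-- **THE GRID-SHAPED BASE LAW IN FLOOR-KEYED LEVELLED UNITS** (`klLevUnitF`, p668906): the same bound.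
[cite: BenfattoGiulianiMastropietro2006, §2.8 (2.83), (2.93)-(2.98)] -/
theorem gridLaw_div_klLevUnitF_le [NeZero M] {β : ℝ} (hβ : 0 < β) {A P lam : ℝ} (hA : 0 ≤ A) (hP : 0 ≤ P) (hlam : 0 < lam)
    (t : Fin 5) {p : ℕ} (hp : 1 ≤ p) (J : ℕ) :
    imagTimeWeight β M ^ (2 * p - 1) * A * P ^ p / klLevUnitF β M t p J ≤
      ((2 : ℝ) ^ (7 * J) * A * lam) * lam ^ (p - 1) * (P / ((8 : ℝ) ^ J * lam)) ^ p := by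
  have hε : 0 ≤ imagTimeWeight β M := imagTimeWeight_nonneg hβ.le M
  have hN0 : 0 ≤ imagTimeWeight β M ^ (2 * p - 1) * A * P ^ p := by positivity
  have hut : 0 < klLevUnitF β M t p J := klLevUnitF_pos hβ t p J
  have hu0 : 0 < klLevUnit β M 0 p J := klLevUnit_pos hβ 0 p J
  rw [← gridLaw_mul_four_pow_div_klLevUnit_zero (M := M) hβ hlam.ne' hp J, div_le_div_iff₀ hut hu0]
  calc imagTimeWeight β M ^ (2 * p - 1) * A * P ^ p * klLevUnit β M 0 p J
      ≤ imagTimeWeight β M ^ (2 * p - 1) * A * P ^ p * ((4 : ℝ) ^ J * klLevUnitF β M t p J) :=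
        mul_le_mul_of_nonneg_left (klLevUnitF_zero_le_four_pow_mul hβ t p J) hN0
    _ = imagTimeWeight β M ^ (2 * p - 1) * A * P ^ p * (4 : ℝ) ^ J * klLevUnitF β M t p J := by ring

/-! ## §3 The floor twin of the base profile -/

/-- **THE BASE PROFILE IN FLOOR UNITS**: `klTowerMuLevF … d k m ≤ (27⁵·2^{7J}·A·λ)·λ^{m−1}·(P/(8^J·λ))^m` under the hypotheses of
`klTowerMuLev_le_profile_of_wtPinned` (free transfer `klTowerMuLevF_le_klTowerMuLev`). [cite: BenfattoGiulianiMastropietro2006, §2.8 (2.83), (2.93)-(2.98)] -/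
theorem klTowerMuLevF_le_profile_of_wtPinned [NeZero M] {β : ℝ} (hβ : 0 < β) (U μ : ℝ) (K : TrigPolyC4v) (d k j : ℕ) {A P : ℝ} (hA : 0 ≤ A) (hP : 0 ≤ P)
    (h : ∀ m, 1 ≤ m → ∀ (q : Fin (2 * m)) (w : SpaceTimeIdx L M × SectorLeg (sectorCount (d * k - 1))),
      klWtPinnedSumAt L M β μ K (d * k - 1) j (2 * m) (klTowerInput L M β U μ K d k) q w ≤ imagTimeWeight β M ^ (2 * m - 1) * A * P ^ m)
    {lam : ℝ} (hlam : 0 < lam) {m : ℕ} (hm : 1 ≤ m) :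
    klTowerMuLevF L M β U μ K d k m ≤
      ((27 : ℝ) ^ 5 * (2 : ℝ) ^ (7 * (d * k - 1)) * A * lam) * lam ^ (m - 1) * (P / ((8 : ℝ) ^ (d * k - 1) * lam)) ^ m :=
  (klTowerMuLevF_le_klTowerMuLev hβ U μ K d k m).trans (klTowerMuLev_le_profile_of_wtPinned hβ U μ K d k j hA hP h hlam hm)

end Summit.HubbardSuperconductivity.HubbardSuperconductivity.Theorems.EngineV8

end
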